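import Summits.Ventures.QEC.Census.CertCoverBatch
import Summits.Ventures.QEC.Census.TwoBGA.TB_l6m24_A0_0_0_1_3_11_B0_0_1_11_5_4.CoreDefs
import HarnessLib

set_option Elab.async false
set_option maxRecDepth 200000

/-!
# `[[288,12,16]]` one-level cover certificate of `TB_l6m24_A0_0_0_1_3_11_B0_0_1_11_5_4` — LEVEL-1→0 coset problems 54…66 (deep problems [5] excluded: `ProbDeep*.lean`) as COMPACT data
(`ProbData`: U, f, σ, y₀, allow; qec-type-10 `CertCoverBatch.mkCoset` rebuilds each `CosetProb` in the kernel) + their verdict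
`probsOK cov covR hx hx1 D1 lxd 14` (one `decide +kernel`; 13 problems, depths f=0:8 f=1:4 f=2:1 f=3:0, est. 100.0 s).
qec-search-1 g5 (pattern of search-9 g5 `Probs*`); data from JSON `level10.problems` (sha256 fee0559d1bce5e88…). Data + decided check; KERNEL.
-/

namespace Summit.Ventures.QEC.Census.TB_l6m24_A0_0_0_1_3_11_B0_0_1_11_5_4

open Matrix Summit.Ventures.QEC.Census Literature.InformationTheory.QuantumCodes

/-- Problems 54…66 (13): `⟨U, f, σ, y₀, allow⟩`. -/
def probs05 : List ProbData := [
    ⟨1344804945781736744157541360606384153, 0, 46117426432774766592, 94447329657392904278040, [0]⟩,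
    ⟨1344804945781944472943120553925935105, 1, 1610629184, 1329228055206339990056963915961597953, [0]⟩,
    ⟨1349997242640403816494336280719532065, 1, 110681594740210663424, 1329228055206264432193238000564445217, [0]⟩,
    ⟨1349997242640894905716196872208519185, 0, 55340797373326590080, 20769187434139347408740430689337344, [0]⟩,
    ⟨1355189539499618591111119156977598465, 0, 2684403904, 1329228055206944452966771228401467393, [0]⟩,
    ⟨1360381836357851187284180845962723329, 2, 3221258368, 31153781151208965772313275928674304, [0, 2147483648]⟩,
    ⟨1361030873474844171966990070261481472, 0, 2305843149874956416, 1329228055206646943878350439679262720, [0]⟩,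
    ⟨1365574133216442701757249851735670793, 0, 27670117213309796480, 31153781151265634170107711671238664, [0]⟩,
    ⟨1370766430074769874386612303844884545, 1, 221363189480421326848, 1329228055206491105784415743534710849, [0]⟩,
    ⟨1381151023793199423620178060655984641, 0, 5368807808, 1329228055207851147331482203503722497, [0]⟩,
    ⟨1391535597799338643265760955597852674, 0, 885444278902484713730, 1329228035400206055856153436180447234, [0]⟩,
    ⟨1391535617509664615966301442921201665, 1, 6442516736, 1391535617508455690146686809451528193, [0]⟩,
    ⟨1412304775271626378402082318092109952, 0, 4521329252379648, 83076749775242868284156212297074688, [0]⟩]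

set_option maxHeartbeats 400000000 in
/-- Every problem of this chunk passes (`mkCoset` elimination + `cosetOKD` + fast `σ` + depth + `BU`-evenness + label checks). -/
theorem probs05_ok : probsOK TB_l6m24_A0_0_0_1_3_11_B0_0_1_11_5_4.cov covR hx hx1 D1 lxd 14 probs05 = true := by
  decide +kernel

/-- Pointwise form. -/
theorem probs05_all : ∀ x ∈ TB_l6m24_A0_0_0_1_3_11_B0_0_1_11_5_4.probs05, probOK cov covR hx hx1 D1 lxd 14 x = true := by
  have h := probs05_ok
  rwa [probsOK, List.all_eq_true] at h

end Summit.Ventures.QEC.Census.TB_l6m24_A0_0_0_1_3_11_B0_0_1_11_5_4
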